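import Mathlib.Analysis.SpecialFunctions.Pow.Real
import Mathlib.Algebra.Order.BigOperators.Ring.Finset
import HarnessLib

/-!
# `PP ⊆ PostBQP`, I: the scale ladder and the one-shot product test

Topic `Literature/Computability/QuantumComplexity`; first file of a series proving Aaronson's
inclusion `PP ⊆ PostBQP` (S. Aaronson, *Quantum computing, postselection, and probabilistic
polynomial-time*, Proc. R. Soc. A 461 (2005) 3473–3482, Thm. 4 `PostBQP = PP`, the direction
proved on pp. 5–6 of arXiv:quant-ph/0412187) in the tree's model of `PostBQP`
(`Cryptography/Postselection.lean`: uniform Clifford+T families, output wire `0`, post-selection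
wire `1`, thresholds `2/3`, `1/3`), which — with post-BQP error reduction
(`PostBQP_subset_PostBQPWith_holds`) and the Hadamard gadget (`PostBQPWith_subset_PostIQPWith`) —
yields Bremner–Jozsa–Shepherd's Thm. 1 `PP ⊆ PostIQPWith ε` (`PP_subset_PostIQPWith`,
`IQPPostselection.lean`).

**The printed proof and the variant formalised in this series.** For `f : {0,1}^n → {0,1}`
efficiently computable with `s = |f⁻¹(1)|`, Aaronson prepares `2^{-n/2} Σ_x |x⟩|f(x)⟩`, applies
Hadamards to the first register and post-selects it on `0^n`, leaving the qubit
`|ψ⟩ ∝ (2^n - s)|0⟩ + s|1⟩`; he then prepares `α|0⟩|ψ⟩ + β|1⟩H|ψ⟩`, post-selects, and argues that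
for SOME ratio `β/α = 2^i`, `i ∈ [-n, n]`, the reduced state is `0.985`-close to `|+⟩` when
`s < 2^{n-1}` and never closer than `1/√2` when `s ≥ 2^{n-1}`; `n(2n+1)` repetitions and their
statistics finish the proof. The series keeps the first half verbatim (uniform superposition,
reversible computation, Hadamards, post-selection on `0…0`) and replaces the scan over `i`
followed by repetitions by a **one-shot product test**: the `2n + O(1)` scales `2^i` are realised
inside the counting predicate (one block of coins per scale, file II), each block `i` ending in a
pair of outcomes of Born weights proportional to `(C + 2^i G)²` ("sign guess `+`") and
`(C - 2^i G)²` ("sign guess `-`"), where `G ≠ 0` is (twice) the gap `2s - 2^n` shifted to be odd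
and `C` a fixed power of two; post-selecting on "all blocks guess the same sign" the conditional
probability of the guess `+` is `Π_i (C + 2^i G)² / (Π_i (C + 2^i G)² + Π_i (C - 2^i G)²)`. This
file proves the elementary real-number facts that make this a bounded-error test:

* `sq_sub_le_sq_add`: every scale is (weakly) informative, `(C - a)² ≤ (C + a)²` for `a, C ≥ 0`;
* `four_mul_sq_sub_le_sq_add`: a scale with `C/3 ≤ a ≤ 3C` is decisive, `4 (C - a)² ≤ (C + a)²`;
* `exists_decisive_scale`: if `0 < G ≤ 3C` and `C ≤ 3 · 2^J G` then some `i ≤ J` has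
  `2^i G ∈ [C/3, 3C]` (Aaronson: "there must be an integer `i ∈ [-n, n-1]` such that
  `|φ_{2^i}⟩` and `|φ_{2^{i+1}}⟩` fall on opposite sides of `|+⟩`");
* `four_mul_prod_sq_sub_le`: hence `4 Π_{i ≤ J} (C - 2^i G)² ≤ Π_{i ≤ J} (C + 2^i G)²` for `G > 0`;
* `two_thirds_le_div_add`, `div_add_le_one_third`: the resulting conditional probabilities clear
  the thresholds `2/3`, `1/3` of `PostBQP`.

## References

* S. Aaronson, *Quantum computing, postselection, and probabilistic polynomial-time*, Proc. R.
  Soc. A 461 (2005) 3473–3482, doi:10.1098/rspa.2005.1546, arXiv:quant-ph/0412187: Def. 1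
  (`PostBQP`), Thm. 4 (`PostBQP = PP`) and its proof (the scales `β/α = 2^i`).
* M. J. Bremner, R. Jozsa, D. J. Shepherd, *Classical simulation of commuting quantum
  computations implies collapse of the polynomial hierarchy*, Proc. R. Soc. A 467 (2011)
  459–472, arXiv:1005.1407: Thm. 1 (`post-IQP = post-BQP = PP`, importing Aaronson's theorem).
-/

namespace Literature.Computability.QuantumComplexity

namespace PPPostBQP

open Finset

/-! ### One scale -/

/-- Every scale is weakly informative: `(C - a)² ≤ (C + a)²` for `a, C ≥ 0`. [folklore] -/
theorem sq_sub_le_sq_add {C a : ℝ} (hC : 0 ≤ C) (ha : 0 ≤ a) : (C - a) ^ 2 ≤ (C + a) ^ 2 := by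
  nlinarith [mul_nonneg hC ha]

/-- A scale `a ∈ [C/3, 3C]` is decisive: `4 (C - a)² ≤ (C + a)²` (Aaronson's worst case
`⟨+|φ⟩² = (1+√2)²/6`: here with the cruder constant `4`). [cite: Aaronson2005, Thm. 4 (proof)] -/
theorem four_mul_sq_sub_le_sq_add {C a : ℝ} (h1 : C ≤ 3 * a) (h2 : a ≤ 3 * C) :
    4 * (C - a) ^ 2 ≤ (C + a) ^ 2 := by
  nlinarith [h1, h2]

/-- **The decisive scale exists.** If `0 < G ≤ 3C` and `C ≤ 3 · 2^J · G` then some `i ≤ J` has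
`C ≤ 3 · 2^i G` and `2^i G ≤ 3 C` (the least `i` with `C ≤ 3 · 2^i G`: either `i = 0`, or the
previous scale was below `C/3`, so this one is below `2C/3`). [cite: Aaronson2005, Thm. 4 (proof)] -/
theorem exists_decisive_scale {C G : ℝ} (hG : 0 < G) {J : ℕ} (hlo : G ≤ 3 * C)
    (hhi : C ≤ 3 * 2 ^ J * G) : ∃ i ≤ J, C ≤ 3 * (2 ^ i * G) ∧ 2 ^ i * G ≤ 3 * C := by
  classical
  have hex : ∃ i, C ≤ 3 * (2 ^ i * G) := ⟨J, by rw [← mul_assoc]; exact hhi⟩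
  refine ⟨Nat.find hex, ?_, Nat.find_spec hex, ?_⟩
  · exact Nat.find_min' hex (by rw [← mul_assoc]; exact hhi)
  · rcases h0 : Nat.find hex with _ | k
    · simpa using hlo
    · have hk : ¬ C ≤ 3 * (2 ^ k * G) := Nat.find_min hex (by rw [h0]; exact Nat.lt_succ_self k)
      rw [pow_succ]
      nlinarith [hk, pow_pos (two_pos : (0:ℝ) < 2) k]

/-! ### The product over all scales -/

/-- A product of nonnegative reals with termwise bounds, one term carrying an extra factor `4`:
`4 Π f ≤ Π g` if `0 ≤ f i ≤ g i` for all `i ∈ s` and `4 f i₀ ≤ g i₀` for some `i₀ ∈ s`. [folklore] -/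
theorem four_mul_prod_le_prod {ι : Type*} [DecidableEq ι] {s : Finset ι} {f g : ι → ℝ}
    (hf : ∀ i ∈ s, 0 ≤ f i) (hfg : ∀ i ∈ s, f i ≤ g i) {i₀ : ι} (hi₀ : i₀ ∈ s)
    (h4 : 4 * f i₀ ≤ g i₀) : 4 * ∏ i ∈ s, f i ≤ ∏ i ∈ s, g i := by
  rw [← mul_prod_erase s f hi₀, ← mul_prod_erase s g hi₀, ← mul_assoc]
  refine mul_le_mul h4 (prod_le_prod (fun i hi => hf i (mem_of_mem_erase hi))
    (fun i hi => hfg i (mem_of_mem_erase hi))) (prod_nonneg fun i hi => hf i (mem_of_mem_erase hi)) ?_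
  exact le_trans (by linarith [hf i₀ hi₀]) h4

/-- **The one-shot product test, `+` side.** For `0 < G ≤ 3C` and `C ≤ 3 · 2^J · G`:
`4 Π_{i ≤ J} (C - 2^i G)² ≤ Π_{i ≤ J} (C + 2^i G)²`. [cite: Aaronson2005, Thm. 4 (proof)] -/
theorem four_mul_prod_sq_sub_le {C G : ℝ} (hC : 0 ≤ C) (hG : 0 < G) {J : ℕ} (hlo : G ≤ 3 * C)
    (hhi : C ≤ 3 * 2 ^ J * G) :
    4 * ∏ i ∈ range (J + 1), (C - 2 ^ i * G) ^ 2 ≤ ∏ i ∈ range (J + 1), (C + 2 ^ i * G) ^ 2 := by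
  obtain ⟨i₀, hi₀, h1, h2⟩ := exists_decisive_scale hG hlo hhi
  exact four_mul_prod_le_prod (fun i _ => sq_nonneg _)
    (fun i _ => sq_sub_le_sq_add hC (by positivity)) (mem_range.2 (Nat.lt_succ_of_le hi₀))
    (four_mul_sq_sub_le_sq_add h1 h2)

/-- **The one-shot product test, `-` side** (`G < 0`, by `G ↦ -G`):
`4 Π_{i ≤ J} (C + 2^i G)² ≤ Π_{i ≤ J} (C - 2^i G)²`. [cite: Aaronson2005, Thm. 4 (proof)] -/
theorem four_mul_prod_sq_add_le {C G : ℝ} (hC : 0 ≤ C) (hG : G < 0) {J : ℕ} (hlo : -G ≤ 3 * C)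
    (hhi : C ≤ 3 * 2 ^ J * (-G)) :
    4 * ∏ i ∈ range (J + 1), (C + 2 ^ i * G) ^ 2 ≤ ∏ i ∈ range (J + 1), (C - 2 ^ i * G) ^ 2 := by
  have h := four_mul_prod_sq_sub_le hC (neg_pos.2 hG) hlo hhi
  simp only [mul_neg, sub_neg_eq_add] at h
  simpa only [mul_neg, ← sub_eq_add_neg] using h

/-- Products with positive per-scale weights: if `4 Π a ≤ Π b` and the weights are nonnegative,
then `4 Π (κ i · a i) ≤ Π (κ i · b i)`. [folklore] -/
theorem four_mul_prod_mul_le {J : ℕ} {κ a b : ℕ → ℝ} (hκ : ∀ i, 0 ≤ κ i)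
    (h : 4 * ∏ i ∈ range (J + 1), a i ≤ ∏ i ∈ range (J + 1), b i) :
    4 * ∏ i ∈ range (J + 1), (κ i * a i) ≤ ∏ i ∈ range (J + 1), (κ i * b i) := by
  rw [prod_mul_distrib, prod_mul_distrib, mul_left_comm]
  exact mul_le_mul_of_nonneg_left h (prod_nonneg fun i _ => hκ i)

/-! ### Thresholds -/

/-- If the wrong side has at most a quarter of the weight of the right side, the conditional
probability of the right side is at least `2/3` (indeed `4/5`). [folklore] -/
theorem two_thirds_le_div_add {a r : ℝ} (ha : 0 < a) (hr : 0 ≤ r) (h : 4 * r ≤ a) :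
    2 / 3 ≤ a / (a + r) := by
  rw [le_div_iff₀ (by linarith)]
  linarith

/-- If the right side has at most a quarter of the weight of the wrong side, the conditional
probability of the right side is at most `1/3` (indeed `1/5`). [folklore] -/
theorem div_add_le_one_third {a r : ℝ} (ha : 0 ≤ a) (hr : 0 < r) (h : 4 * a ≤ r) :
    a / (a + r) ≤ 1 / 3 := by
  rw [div_le_iff₀ (by linarith)]
  linarith

/-- The weights of the test are positive on the right side: `Π (C + 2^i G)² > 0` for `G, C > 0`. [folklore] -/
theorem prod_sq_add_pos {C G : ℝ} (hC : 0 < C) (hG : 0 < G) (J : ℕ) :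
    0 < ∏ i ∈ range (J + 1), (C + 2 ^ i * G) ^ 2 :=
  prod_pos fun i _ => by positivity

/-- The weights of the test are positive on the right side: `Π (C - 2^i G)² > 0` for `C > 0 > G`. [folklore] -/
theorem prod_sq_sub_pos {C G : ℝ} (hC : 0 < C) (hG : G < 0) (J : ℕ) :
    0 < ∏ i ∈ range (J + 1), (C - 2 ^ i * G) ^ 2 :=
  prod_pos fun i _ => by
    have : 0 < C - 2 ^ i * G := by nlinarith [pow_pos (two_pos : (0:ℝ) < 2) i]
    positivity

end PPPostBQP

end Literature.Computability.QuantumComplexity
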